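import Literature.AlgebraicGeometry.Modules.CechRefineClasses
import Literature.Algebra.Homology.OrderedCechSystemRefineComp
import Literature.Algebra.Homology.OrderedCechSystemRefineConst
import HarnessLib

/-!
# Pull-back of ordered Čech classes of the structure sheaf is FUNCTORIAL: `(g ≫ f)^* = g^* ∘ f^*`, `𝟙^* = 𝟙`,
# and a pull-back with a constant index map kills positive degrees (The Stacks Project, Tags 01FG, 01FP)

Layer `Literature/AlgebraicGeometry/Modules` (THEOREMS only: no definition, no instance, no notation, no named fact,
no `sorry`).  Cell `hodgecm-mathlib` FLOOR 0, P1 sub-line F-11, packet (iv)∕J3 «`Ȟ¹ ⊗ Ȟ¹ ↠ Ȟ²` for an abelian variety»,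
letter (G1-c∘) «composites of pull-backs on classes» (consumer: F0P1b-p02 (g2)'s F-J3b skeleton, stubs `hi₁p₁`, `hi₂p₂`,
`hi₁p₂`, `hi₂p₁`, `hswp₁`, `hswp₂`, `hi₁m`, `hi₂m`, `hswm`); F0P1a-p02 (g3).  HC_CM is proved only modulo the 7 printed
citations until rung 0 closes — nothing here bears on a summit statement.

For a scheme morphism `f : Y ⟶ X`, covers `U : ι → X.Opens`, `V : ι' → Y.Opens`, an ADMISSIBLE index map `θ`
(`V_c ⊆ f⁻¹ U_{θ c}`) and base rings `ρX`, `ρY = f^* ∘ ρX`, ★ `Modules.pullbackSystemHom f U V θ …` (DEF #14) is the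
restriction datum along which ★ `OrderedCech.refineComplexMap θ` (DEF #15) refines ordered Čech cochains; the composite
`refineComplexMap θ (pullbackSystemHom f U V θ …) : Č(U, 𝒪_X) ⟶ Č(V, 𝒪_Y)` is the cochain-level pull-back `f^♯` and
`HomologicalComplex.homologyMap` of it is `f^*` on classes ([StacksProject, Tag 01FG]).  This file proves, ON THE NOSE at the
level of cochain maps (hence for classes in every degree):

* (tools, ★ `Modules/CechRefineClasses`, F0P1b-p02 (g2): `refineCochain_id_apply` — refinement along a pointwise-identity
  index map with restriction data is the identity on cochains; `pullbackSystemHom_comp_app` — the datum of `g ≫ f` with the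
  composite index map is the composite datum, the «characterised composite» hypothesis of ★ `OrderedCech.refineCochain_comp`;
  `pullbackSystemHom_id_app`);
* §1 **`refineComplexMap_pullbackSystemHom_comp`** — `f^♯ ≫ g^♯ = (g ≫ f)^♯`, stated for ANY morphism `fc = g ≫ f` and ANY
  index map `θc` pointwise equal to `θ ∘ θ'` (so that consumers rewrite along scheme identities such as `i₁ ≫ p₁ = 𝟙`,
  `σ ≫ m = m` and along definitional unfoldings of their index maps without dependent-type bookkeeping);
  **`refineComplexMap_pullbackSystemHom_id`** — `(𝟙 X)^♯ = 𝟙` for an index map pointwise equal to the identity;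
  **`homologyMap_refineComplexMap_pullbackSystemHom_eq_zero_of_const`** — for an index map pointwise constant, `f^* = 0` on
  `Ȟⁿ`, `n ≥ 1` (★ (G1-d) `homologyMap_eq_zero_of_refine_const`);
* §2 the same three facts on classes (`homologyMap` composites and their elementwise forms `…_apply`), which is the shape
  the F-J3b assembly consumes (`i₁^* p₁^* = 𝟙`, `i₁^* p₂^* = 0` in positive degree, `σ^* p₁^* = p₂^*`, …).

Index maps are ARBITRARY (neither monotone nor injective): the sign bookkeeping is ★ `refineCochain_comp` (B-p09 (g18)).

## References
* The Stacks Project, Tag 01FG (Čech complex; pull-back along a morphism of ringed spaces with a refinement map),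
  Tag 01FP (refinements compose; independence on classes). [StacksProject]
* R. Godement, *Topologie algébrique et théorie des faisceaux* (1958), II §5.8. [folklore]
* U. Görtz, T. Wedhorn, *Algebraic Geometry II* (2023), Def. 21.68 (p. 180). [GortzWedhorn2023]
-/

noncomputable section

universe u

-- `ModuleCat`-valued functors and `TopCat.Presheaf` are not reducible (as in ★ `OrderedCechSystem`, ★ `CechPullbackSystemHom`).
set_option backward.isDefEq.respectTransparency false

open CategoryTheory AlgebraicGeometry TopologicalSpace Opposite

namespace Literature.AlgebraicGeometry.Modules

open Literature.Algebra.Homology Literature.Algebra.Homology.OrderedCech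

variable {X Y Z : Scheme.{u}} (f : Y ⟶ X) (g : Z ⟶ Y) {ι ι' ι'' : Type} [LinearOrder ι] [LinearOrder ι']
  [LinearOrder ι''] (U : ι → X.Opens) (V : ι' → Y.Opens) (W : ι'' → Z.Opens) (θ : ι' → ι)
  (hθ : ∀ c, V c ≤ f ⁻¹ᵁ U (θ c)) (θ' : ι'' → ι') (hθ' : ∀ d, W d ≤ g ⁻¹ᵁ V (θ' d)) {A : Type u} [CommRing A]
  (ρX : A →+* Γ(X, ⊤)) (ρY : A →+* Γ(Y, ⊤)) (ρZ : A →+* Γ(Z, ⊤)) (hρ : ∀ a, ρY a = f.appTop (ρX a))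
  (hρ' : ∀ a, ρZ a = g.appTop (ρY a))

/-! ## §1 Functoriality of the cochain-level pull-back `f^♯ = refineComplexMap θ (pullbackSystemHom f U V θ …)` -/

/-- **`f^♯ ≫ g^♯ = (g ≫ f)^♯` on ordered Čech cochains of the structure sheaves** — for admissible index maps `θ` (for
`f`, covers `U`, `V`) and `θ'` (for `g`, covers `V`, `W`), ANY morphism `fc` equal to `g ≫ f` and ANY index map `θc`
pointwise equal to `θ ∘ θ'` (with any admissibility and base-ring witnesses for `(fc, θc)`): the composite of the
cochain maps is the cochain map of the composite, ON THE NOSE (★ `refineCochain_comp` + ★ `pullbackSystemHom_comp_app`).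
[cite: StacksProject, Tag 01FP] [cite: StacksProject, Tag 01FG] -/
theorem refineComplexMap_pullbackSystemHom_comp (fc : Z ⟶ X) (hfc : g ≫ f = fc) (θc : ι'' → ι)
    (hθc : ∀ d, θc d = θ (θ' d)) (hθc' : ∀ d, W d ≤ fc ⁻¹ᵁ U (θc d)) (hρc : ∀ a, ρZ a = fc.appTop (ρX a)) :
    refineComplexMap θ (pullbackSystemHom f U V θ hθ ρX ρY hρ) ≫
        refineComplexMap θ' (pullbackSystemHom g V W θ' hθ' ρY ρZ hρ') =
      refineComplexMap θc (pullbackSystemHom fc U W θc hθc' ρX ρZ hρc) := by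
  subst hfc
  obtain rfl : θc = θ ∘ θ' := funext hθc
  refine HomologicalComplex.hom_ext _ _ fun n => ModuleCat.hom_ext (LinearMap.ext fun c => ?_)
  change refineCochain θ' (pullbackSystemHom g V W θ' hθ' ρY ρZ hρ') n
      (refineCochain θ (pullbackSystemHom f U V θ hθ ρX ρY hρ) n c) =
    refineCochain (θ ∘ θ') (pullbackSystemHom (g ≫ f) U W (θ ∘ θ') hθc' ρX ρZ hρc) n c
  exact refineCochain_comp θ _ θ' _ _
    (pullbackSystemHom_comp_app f g U V W θ θ' hθ hθ' hθc' ρX ρY ρZ hρ hρ' hρc) n c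

/-- **`(𝟙 X)^♯ = 𝟙` on ordered Čech cochains** — for ANY morphism `f₁` equal to `𝟙 X` and ANY index map `θ₁` pointwise
equal to the identity (with any admissibility and base-ring witnesses): the cochain map is the identity (★ `refineCochain_id_apply` + ★
`pullbackSystemHom_id_app`). [cite: StacksProject, Tag 01FG] -/
theorem refineComplexMap_pullbackSystemHom_id (f₁ : X ⟶ X) (hf₁ : f₁ = 𝟙 X) (θ₁ : ι → ι) (hθ₁ : ∀ i, θ₁ i = i)
    (h₁ : ∀ c, U c ≤ f₁ ⁻¹ᵁ U (θ₁ c)) (hρ₁ : ∀ a, ρX a = f₁.appTop (ρX a)) :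
    refineComplexMap θ₁ (pullbackSystemHom f₁ U U θ₁ h₁ ρX ρX hρ₁) = 𝟙 (cechComplex U (unitModule X) ρX) := by
  subst hf₁
  refine HomologicalComplex.hom_ext _ _ fun n => ModuleCat.hom_ext (LinearMap.ext fun c => ?_)
  change refineCochain θ₁ (pullbackSystemHom (𝟙 X) U U θ₁ h₁ ρX ρX hρ₁) n c = c
  have himg : ∀ s : Finset ι, s.image θ₁ ⊆ s := fun s i hi => by
    obtain ⟨j, hj, rfl⟩ := Finset.mem_image.1 hi
    rwa [hθ₁]
  exact refineCochain_id_apply θ₁ hθ₁ _ himg (pullbackSystemHom_id_app U θ₁ himg h₁ ρX hρ₁) n c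

/-- **A pull-back with a CONSTANT index map is `0` on `Ȟⁿ` for `n ≥ 1`** — for ANY index map `θ` pointwise constant
(`θ c = i₀`: «every `V_c` lies in `f⁻¹ U_{i₀}`»), `HomologicalComplex.homologyMap (f^♯) n = 0` (★ (G1-d)
`homologyMap_eq_zero_of_refine_const`: the refined tuple repeats an index). [cite: StacksProject, Tag 01FG]
[cite: StacksProject, Tag 01FP] -/
theorem homologyMap_refineComplexMap_pullbackSystemHom_eq_zero_of_const (i₀ : ι) (hconst : ∀ c, θ c = i₀) {n : ℤ}
    (hn : 1 ≤ n) :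
    HomologicalComplex.homologyMap (refineComplexMap θ (pullbackSystemHom f U V θ hθ ρX ρY hρ)) n = 0 := by
  obtain rfl : θ = fun _ => i₀ := funext hconst
  exact homologyMap_eq_zero_of_refine_const i₀ (pullbackSystemHom f U V (fun _ => i₀) hθ ρX ρY hρ) _ hn
    fun c => rfl

/-! ## §2 The same facts on classes -/

/-- **`f^* ≫ g^* = (g ≫ f)^*` on `Ȟⁿ`** (any `fc = g ≫ f`, any `θc` pointwise `θ ∘ θ'`).
[cite: StacksProject, Tag 01FP] -/
theorem homologyMap_pullbackSystemHom_comp (fc : Z ⟶ X) (hfc : g ≫ f = fc) (θc : ι'' → ι)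
    (hθc : ∀ d, θc d = θ (θ' d)) (hθc' : ∀ d, W d ≤ fc ⁻¹ᵁ U (θc d)) (hρc : ∀ a, ρZ a = fc.appTop (ρX a))
    (n : ℤ) :
    HomologicalComplex.homologyMap (refineComplexMap θ (pullbackSystemHom f U V θ hθ ρX ρY hρ)) n ≫
        HomologicalComplex.homologyMap (refineComplexMap θ' (pullbackSystemHom g V W θ' hθ' ρY ρZ hρ')) n =
      HomologicalComplex.homologyMap (refineComplexMap θc (pullbackSystemHom fc U W θc hθc' ρX ρZ hρc)) n := by
  rw [← HomologicalComplex.homologyMap_comp,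
    refineComplexMap_pullbackSystemHom_comp f g U V W θ hθ θ' hθ' ρX ρY ρZ hρ hρ' fc hfc θc hθc hθc' hρc]

/-- **`g^*(f^*(x)) = (g ≫ f)^*(x)`** for a class `x ∈ Ȟⁿ(U, 𝒪_X)` (elementwise form of `homologyMap_pullbackSystemHom_comp`).
[cite: StacksProject, Tag 01FP] -/
theorem homologyMap_pullbackSystemHom_comp_apply (fc : Z ⟶ X) (hfc : g ≫ f = fc) (θc : ι'' → ι)
    (hθc : ∀ d, θc d = θ (θ' d)) (hθc' : ∀ d, W d ≤ fc ⁻¹ᵁ U (θc d)) (hρc : ∀ a, ρZ a = fc.appTop (ρX a))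
    (n : ℤ) (x : (cechComplex U (unitModule X) ρX).homology n) :
    (HomologicalComplex.homologyMap (refineComplexMap θ' (pullbackSystemHom g V W θ' hθ' ρY ρZ hρ')) n).hom
        ((HomologicalComplex.homologyMap (refineComplexMap θ (pullbackSystemHom f U V θ hθ ρX ρY hρ)) n).hom x) =
      (HomologicalComplex.homologyMap (refineComplexMap θc (pullbackSystemHom fc U W θc hθc' ρX ρZ hρc)) n).hom x := by
  rw [← homologyMap_pullbackSystemHom_comp f g U V W θ hθ θ' hθ' ρX ρY ρZ hρ hρ' fc hfc θc hθc hθc' hρc n]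
  rfl

/-- **`(𝟙 X)^* = 𝟙` on `Ȟⁿ`** (any `f₁ = 𝟙 X`, any `θ₁` pointwise the identity). [cite: StacksProject, Tag 01FG] -/
theorem homologyMap_pullbackSystemHom_id (f₁ : X ⟶ X) (hf₁ : f₁ = 𝟙 X) (θ₁ : ι → ι) (hθ₁ : ∀ i, θ₁ i = i)
    (h₁ : ∀ c, U c ≤ f₁ ⁻¹ᵁ U (θ₁ c)) (hρ₁ : ∀ a, ρX a = f₁.appTop (ρX a)) (n : ℤ) :
    HomologicalComplex.homologyMap (refineComplexMap θ₁ (pullbackSystemHom f₁ U U θ₁ h₁ ρX ρX hρ₁)) n =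
      𝟙 ((cechComplex U (unitModule X) ρX).homology n) := by
  rw [refineComplexMap_pullbackSystemHom_id U ρX f₁ hf₁ θ₁ hθ₁ h₁ hρ₁, HomologicalComplex.homologyMap_id]

/-- **`(𝟙 X)^*(x) = x`** for a class `x` (elementwise form). [cite: StacksProject, Tag 01FG] -/
theorem homologyMap_pullbackSystemHom_id_apply (f₁ : X ⟶ X) (hf₁ : f₁ = 𝟙 X) (θ₁ : ι → ι) (hθ₁ : ∀ i, θ₁ i = i)
    (h₁ : ∀ c, U c ≤ f₁ ⁻¹ᵁ U (θ₁ c)) (hρ₁ : ∀ a, ρX a = f₁.appTop (ρX a)) (n : ℤ)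
    (x : (cechComplex U (unitModule X) ρX).homology n) :
    (HomologicalComplex.homologyMap (refineComplexMap θ₁ (pullbackSystemHom f₁ U U θ₁ h₁ ρX ρX hρ₁)) n).hom x = x := by
  rw [homologyMap_pullbackSystemHom_id U ρX f₁ hf₁ θ₁ hθ₁ h₁ hρ₁ n]
  rfl

/-- **`f^*(x) = 0`** for a class `x` of degree `n ≥ 1` when the index map is pointwise constant (elementwise form).
[cite: StacksProject, Tag 01FG] -/
theorem homologyMap_pullbackSystemHom_apply_eq_zero_of_const (i₀ : ι) (hconst : ∀ c, θ c = i₀) {n : ℤ} (hn : 1 ≤ n)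
    (x : (cechComplex U (unitModule X) ρX).homology n) :
    (HomologicalComplex.homologyMap (refineComplexMap θ (pullbackSystemHom f U V θ hθ ρX ρY hρ)) n).hom x = 0 := by
  rw [homologyMap_refineComplexMap_pullbackSystemHom_eq_zero_of_const f U V θ hθ ρX ρY hρ i₀ hconst hn]
  rfl

end Literature.AlgebraicGeometry.Modules

end
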